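import Summits.MatrixMultiplication.OmegaCensus.STPPSmallPatternT2K5SeedWitnessesA
import Summits.MatrixMultiplication.OmegaCensus.STPPSmallPatternT2K5SeedWitnessesB
import Summits.MatrixMultiplication.OmegaCensus.STPPSmallPatternT2K5SeedWitnessesC
import Summits.MatrixMultiplication.OmegaCensus.STPPSmallPatternT2K5OrderLawCore
import Summits.MatrixMultiplication.OmegaCensus.STPPSmallPatternT2AboveOnsetTypes
import Summits.MatrixMultiplication.OmegaCensus.STPPSmallPatternOnsetLaws

/-!
# ω-census, small STPP pattern `(1,2,2)^k`: THE HOST LAW «EVERY FINITE ABELIAN GROUP OF ORDER ≥ 48 HOSTS (1,2,2)⁵» (kernel)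

HONEST FRAMING (pub-omega census; verbatim): lottery ticket; floor = certified bounds/negative ranges.
Census STRUCTURE bookkeeping of the STPP track (seat pub-omega-stpp-3, gen 25; STRUCTURE row B5, column `T2`, `k = 5` UPPER side: prediction
P-087 .2 above the conjectured onset `48`), not progress on `ω`: small patterns in small groups bound no exponent.

* `exists_isSTPP_122pow5_of_card_ge_48` — **every finite abelian group of order `≥ 48` admits an STPP family of size pattern `(1,2,2)⁵`.**
  No `iff` is claimed: the `k = 5` NONE side below `48` (the conjectured onset) is not kernel-complete.

Proof: exponent `≥ 48` ⇒ ENG2's ray `exists_isSTPP_122pow5_of_addOrderOf`; exponent `= 47` ⇒ every structure-theorem factor divides the prime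
`47`, so the nontrivial factors are all `47` and there are at least two ⇒ `dom [47, 47]` ⇒ the seed `(ℤ/47)²` (`exists_isSTPP_122pow5_seed_47_47`); exponent
`≤ 46` ⇒ the capped-multiset machinery of `STPP222CubeFrom46` (a prime power dividing `E ≤ 46` is `≤ 45`, as `46 = 2·23` is not one; cap bound
`cap_spec` at `46`, is replaced by the sharper kernel fact `cap_spec49`: every cap alone gives `v ^ cap ≥ 49 ≥ 48`), the kernel domination core `hostCore122K5_of_capped` of `…T2K5OrderLawCore` (≈ 2.0k capped multisets, one decision per
`E ≤ 46`; checked in Python first, 0 exceptions) onto 61 greedy-minimal prime-power seed types, their decide witnesses (`…T2K5SeedWitnessesA/B/C`, ENG2's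
`exists_isSTPP_122pow5_zmod7_zmod7`), `exists_emb_of_dom`, transport.

References: H. Cohn, R. Kleinberg, B. Szegedy, C. Umans, FOCS 2005 (arXiv:math/0511460), Def. 5.1.  Records: HOME `pub-omega-stpp-3-g25/work/t2k5/`.
-/

open Literature.Computability.AlgebraicComplexity Finset

namespace Summit.MatrixMultiplication.OmegaCensus

/-! ## 1. Seeds and the domination core (exponents `≤ 46`) -/

/-- The 61 seed types host `(1,2,2)⁵` (kernel witnesses). [cite: CohnKleinbergSzegedyUmans2005, Def. 5.1] -/
theorem exists_122pow5_of_mem_hostSeeds122K5 : ∀ s ∈ ([[4, 4, 3], [8, 3, 2], [4, 3, 2, 2], [3, 2, 2, 2, 2], [7, 7], [5, 5, 2], [13, 2, 2], [9, 3, 2], [3, 3, 3, 2], [7, 4, 2], [7, 2, 2, 2], [5, 3, 2, 2], [7, 3, 3], [8, 8], [16, 4], [32, 2], [4, 4, 4], [8, 4, 2], [16, 2, 2], [4, 4, 2, 2], [8, 2, 2, 2], [4, 2, 2, 2, 2], [2, 2, 2, 2, 2, 2], [17, 2, 2], [8, 3, 3], [9, 4, 2], [4, 3, 3, 2], [9,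 2, 2, 2], [3, 3, 2, 2, 2], [5, 5, 3], [19, 2, 2], [5, 4, 4], [8, 5, 2], [5, 4, 2, 2], [5, 2, 2, 2, 2], [9, 9], [27, 3], [9, 3, 3], [3, 3, 3, 3], [7, 3, 2, 2], [11, 4, 2], [11, 2, 2, 2], [5, 3, 3, 2], [23, 2, 2], [11, 3, 3], [13, 3, 3], [11, 11], [25, 5], [5, 5, 5], [9, 5, 3], [5, 3, 3, 3], [13, 13], [7, 5, 5], [17, 17], [19, 19], [23, 23], [29, 29], [31, 31], [37, 37], [41, 41], [43, 43]] : List (List ℕ)),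
    ∃ A B C : Fin 5 → Finset (SeedType s), IsSTPP A B C ∧ ∀ i, (A i).card = 1 ∧ (B i).card = 2 ∧ (C i).card = 2 := by
  intro s hs
  simp only [List.mem_cons, List.mem_nil_iff, or_false] at hs
  rcases hs with rfl | rfl | rfl | rfl | rfl | rfl | rfl | rfl | rfl | rfl | rfl | rfl | rfl | rfl | rfl | rfl | rfl | rfl | rfl | rfl | rfl | rfl | rfl | rfl | rfl | rfl | rfl | rfl | rfl | rfl | rfl | rfl | rfl | rfl | rfl | rfl | rfl | rfl | rfl | rfl | rfl | rfl | rfl | rfl | rfl | rfl | rfl | rfl | rfl | rfl | rfl | rfl | rfl | rfl | rfl | rfl | rfl | rfl | rfl | rfl | rfl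
  · exact exists_isSTPP_122pow5_seed_4_4_3
  · exact exists_isSTPP_122pow5_seed_8_3_2
  · exact exists_isSTPP_122pow5_seed_4_3_2_2
  · exact exists_isSTPP_122pow5_seed_3_2_2_2_2
  · exact exists_isSTPP_122pow5_zmod7_zmod7
  · exact exists_isSTPP_122pow5_seed_5_5_2
  · exact exists_isSTPP_122pow5_seed_13_2_2
  · exact exists_isSTPP_122pow5_seed_9_3_2
  · exact exists_isSTPP_122pow5_seed_3_3_3_2
  · exact exists_isSTPP_122pow5_seed_7_4_2
  · exact exists_isSTPP_122pow5_seed_7_2_2_2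
  · exact exists_isSTPP_122pow5_seed_5_3_2_2
  · exact exists_isSTPP_122pow5_seed_7_3_3
  · exact exists_isSTPP_122pow5_seed_8_8
  · exact exists_isSTPP_122pow5_seed_16_4
  · exact exists_isSTPP_122pow5_seed_32_2
  · exact exists_isSTPP_122pow5_seed_4_4_4
  · exact exists_isSTPP_122pow5_seed_8_4_2
  · exact exists_isSTPP_122pow5_seed_16_2_2
  · exact exists_isSTPP_122pow5_seed_4_4_2_2
  · exact exists_isSTPP_122pow5_seed_8_2_2_2
  · exact exists_isSTPP_122pow5_seed_4_2_2_2_2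
  · exact exists_isSTPP_122pow5_seed_2_2_2_2_2_2
  · exact exists_isSTPP_122pow5_seed_17_2_2
  · exact exists_isSTPP_122pow5_seed_8_3_3
  · exact exists_isSTPP_122pow5_seed_9_4_2
  · exact exists_isSTPP_122pow5_seed_4_3_3_2
  · exact exists_isSTPP_122pow5_seed_9_2_2_2
  · exact exists_isSTPP_122pow5_seed_3_3_2_2_2
  · exact exists_isSTPP_122pow5_seed_5_5_3
  · exact exists_isSTPP_122pow5_seed_19_2_2
  · exact exists_isSTPP_122pow5_seed_5_4_4
  · exact exists_isSTPP_122pow5_seed_8_5_2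
  · exact exists_isSTPP_122pow5_seed_5_4_2_2
  · exact exists_isSTPP_122pow5_seed_5_2_2_2_2
  · exact exists_isSTPP_122pow5_seed_9_9
  · exact exists_isSTPP_122pow5_seed_27_3
  · exact exists_isSTPP_122pow5_seed_9_3_3
  · exact exists_isSTPP_122pow5_seed_3_3_3_3
  · exact exists_isSTPP_122pow5_seed_7_3_2_2
  · exact exists_isSTPP_122pow5_seed_11_4_2
  · exact exists_isSTPP_122pow5_seed_11_2_2_2
  · exact exists_isSTPP_122pow5_seed_5_3_3_2
  · exact exists_isSTPP_122pow5_seed_23_2_2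
  · exact exists_isSTPP_122pow5_seed_11_3_3
  · exact exists_isSTPP_122pow5_seed_13_3_3
  · exact exists_isSTPP_122pow5_seed_11_11
  · exact exists_isSTPP_122pow5_seed_25_5
  · exact exists_isSTPP_122pow5_seed_5_5_5
  · exact exists_isSTPP_122pow5_seed_9_5_3
  · exact exists_isSTPP_122pow5_seed_5_3_3_3
  · exact exists_isSTPP_122pow5_seed_13_13
  · exact exists_isSTPP_122pow5_seed_7_5_5
  · exact exists_isSTPP_122pow5_seed_17_17
  · exact exists_isSTPP_122pow5_seed_19_19
  · exact exists_isSTPP_122pow5_seed_23_23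
  · exact exists_isSTPP_122pow5_seed_29_29
  · exact exists_isSTPP_122pow5_seed_31_31
  · exact exists_isSTPP_122pow5_seed_37_37
  · exact exists_isSTPP_122pow5_seed_41_41
  · exact exists_isSTPP_122pow5_seed_43_43

/-- The caps are large enough for the threshold `48`: `v ^ (multiplicity of v in C_E) ≥ 49` for every prime power `v` of `ppList` dividing
`1 ≤ E ≤ 46` (kernel). -/
theorem cap_spec49 : ∀ E ∈ List.range' 1 46, ∀ v ∈ ppList, v ∣ E → 49 ≤ v ^ Multiset.count v (capMS (capList E)) := by
  decide +kernel

/-- A prime power dividing some `E ≤ 46` is `≤ 45` (`46 = 2 · 23` is not a prime power). -/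
theorem primePow_le_45_of_dvd_le_46 {p k E : ℕ} (hp : p.Prime) (hE : E ≤ 46) (hE0 : 0 < E) (h : p ^ k ∣ E) : p ^ k ≤ 45 := by
  have hle : p ^ k ≤ 46 := le_trans (Nat.le_of_dvd hE0 h) hE
  rcases Nat.lt_or_ge (p ^ k) 46 with hlt | hge
  · omega
  · exfalso
    have heq : p ^ k = 46 := le_antisymm hle hge
    have hk : k ≠ 0 := by rintro rfl; simp at heq
    have hpd : p ∣ 2 * 23 := by
      have h46 : p ∣ p ^ k := dvd_pow_self p hk
      rw [heq] at h46
      simpa using h46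
    rcases (Nat.Prime.dvd_mul hp).1 hpd with h2 | h23
    · have hp2 : p = 2 := (Nat.prime_dvd_prime_iff_eq hp Nat.prime_two).1 h2
      subst hp2
      have hk6 : k < 6 := (Nat.pow_lt_pow_iff_right (by norm_num : 1 < 2)).1 (by rw [heq]; norm_num)
      interval_cases k <;> norm_num at heq
    · have hp23 : p = 23 := (Nat.prime_dvd_prime_iff_eq hp (by norm_num)).1 h23
      subst hp23
      have hk2 : k < 2 := (Nat.pow_lt_pow_iff_right (by norm_num : 1 < 23)).1 (by rw [heq]; norm_num)
      interval_cases k <;> norm_num at heq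

/-! ## 2. The law -/

/-- The product form for exponents `≤ 46`. [cite: CohnKleinbergSzegedyUmans2005, Def. 5.1] -/
theorem exists_isSTPP_122pow5_pi {ι : Type} [Fintype ι] [DecidableEq ι] (p e : ι → ℕ)
    (hp : ∀ i, (p i).Prime) {E : ℕ} (hE1 : 1 ≤ E) (hE46 : E ≤ 46) (hdvd : ∀ i, p i ^ e i ∣ E)
    (hcard : 48 ≤ ∏ i, p i ^ e i) :
    ∃ A B C : Fin 5 → Finset (Π i, ZMod (p i ^ e i)), IsSTPP A B C ∧
      ∀ i, (A i).card = 1 ∧ (B i).card = 2 ∧ (C i).card = 2 := by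
  have hq0 : ∀ i, p i ^ e i ≠ 0 := fun i => pow_ne_zero _ (hp i).ne_zero
  set M : Multiset ℕ := (Finset.univ.filter fun i => 0 < e i).val.map fun i => p i ^ e i with hM
  have hprod : 48 ≤ M.prod := by
    have : M.prod = ∏ i, p i ^ e i := by
      rw [hM, ← Finset.prod_eq_multiset_prod]
      exact Finset.prod_filter_of_ne fun i _ hi => Nat.pos_of_ne_zero fun h0 => hi (by rw [h0, pow_zero])
    rw [this]; exact hcard
  have hmem : ∀ a ∈ M, a ∈ ppList ∧ a ∣ E := by
    intro a ha
    obtain ⟨i, hi, rfl⟩ := Multiset.mem_map.1 ha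
    have hi' : 0 < e i := (Finset.mem_filter.1 hi).2
    exact ⟨pow_mem_ppList (hp i) hi' (primePow_le_45_of_dvd_le_46 (hp i) hE46 (by omega) (hdvd i)), hdvd i⟩
  have hEI : E ∈ List.range' 1 46 := List.mem_range'_1.2 ⟨hE1, by omega⟩
  set C := capMS (capList E) with hC
  -- capping keeps the product ≥ 48 (every cap alone gives ≥ 49)
  have hcapd : 48 ≤ (M ∩ C).prod := by
    by_cases hle : M ≤ C
    · have : M ∩ C = M := le_antisymm Multiset.inter_le_left (Multiset.le_inter le_rfl hle)
      rw [this]; exact hprod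
    · rw [Multiset.le_iff_count] at hle
      push Not at hle
      obtain ⟨a, ha⟩ := hle
      have haM : a ∈ M := Multiset.count_pos.1 (by omega)
      have hcnt : Multiset.count a (M ∩ C) = Multiset.count a C := by
        rw [Multiset.count_inter]; omega
      have hrep : Multiset.replicate (Multiset.count a C) a ≤ M ∩ C :=
        Multiset.le_count_iff_replicate_le.1 hcnt.ge
      obtain ⟨R, hR⟩ := Multiset.le_iff_exists_add.1 hrep
      have hRpos : ∀ x ∈ R, 1 ≤ x := fun x hx =>
        one_le_of_mem_ppList (hmem x (Multiset.mem_of_le Multiset.inter_le_left (hR ▸ Multiset.mem_add.2 (Or.inr hx)))).1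
      have h1 : 1 ≤ R.prod := Multiset.one_le_prod_of_one_le hRpos
      rw [hR, Multiset.prod_add, Multiset.prod_replicate]
      calc 48 ≤ 49 := by norm_num
        _ ≤ a ^ Multiset.count a C := cap_spec49 E hEI a (hmem a haM).1 (hmem a haM).2
        _ = a ^ Multiset.count a C * 1 := (mul_one _).symm
        _ ≤ a ^ Multiset.count a C * R.prod := Nat.mul_le_mul_left _ h1
  have hsub : M ∩ C ∈ subMS (capList E) := mem_subMS_of_le _ _ Multiset.inter_le_right
  obtain ⟨s, hs, hD⟩ := hostCore122K5_of_capped E hEI (M ∩ C) hsub hcapd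
  obtain ⟨φ, hφ, -⟩ := exists_emb_of_dom (fun i => p i ^ e i) hq0 s _ (dom_mono s Multiset.inter_le_left hD)
  exact exists_isSTPP_122_of_injective φ hφ (exists_122pow5_of_mem_hostSeeds122K5 s hs)

/-- The product form for exponent exactly `47`: all nontrivial factors are `ℤ/47` and there are at least two, so `(ℤ/47)²` embeds.
[cite: CohnKleinbergSzegedyUmans2005, Def. 5.1] -/
theorem exists_isSTPP_122pow5_pi_47 {ι : Type} [Fintype ι] [DecidableEq ι] (p e : ι → ℕ)
    (hp : ∀ i, (p i).Prime) (hdvd : ∀ i, p i ^ e i ∣ 47) (hcard : 48 ≤ ∏ i, p i ^ e i) :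
    ∃ A B C : Fin 5 → Finset (Π i, ZMod (p i ^ e i)), IsSTPP A B C ∧
      ∀ i, (A i).card = 1 ∧ (B i).card = 2 ∧ (C i).card = 2 := by
  have hq0 : ∀ i, p i ^ e i ≠ 0 := fun i => pow_ne_zero _ (hp i).ne_zero
  set M : Multiset ℕ := (Finset.univ.filter fun i => 0 < e i).val.map fun i => p i ^ e i with hM
  have hprodeq : M.prod = ∏ i, p i ^ e i := by
    rw [hM, ← Finset.prod_eq_multiset_prod]
    exact Finset.prod_filter_of_ne fun i _ hi => Nat.pos_of_ne_zero fun h0 => hi (by rw [h0, pow_zero])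
  have hall : ∀ a ∈ M, a = 47 := by
    intro a ha
    obtain ⟨i, hi, rfl⟩ := Multiset.mem_map.1 ha
    have hi' : 0 < e i := (Finset.mem_filter.1 hi).2
    rcases (Nat.dvd_prime (by norm_num : Nat.Prime 47)).1 (hdvd i) with h1 | h47
    · exfalso
      have : 1 < p i ^ e i := Nat.one_lt_pow hi'.ne' (hp i).one_lt
      omega
    · exact h47
  obtain ⟨c, hc⟩ : ∃ c, M = Multiset.replicate c 47 := ⟨_, Multiset.eq_replicate_card.2 hall⟩
  have hc2 : 2 ≤ c := by
    by_contra hlt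
    have : M.prod ≤ 47 := by
      rw [hc, Multiset.prod_replicate]
      calc 47 ^ c ≤ 47 ^ 1 := Nat.pow_le_pow_right (by norm_num) (by omega)
        _ = 47 := by norm_num
    rw [hprodeq] at this; omega
  have hD : dom [47, 47] M = true :=
    dom_mono [47, 47] (M' := Multiset.replicate 2 47) (by rw [hc]; exact (Multiset.replicate_le_replicate 47).2 hc2) (by decide)
  obtain ⟨φ, hφ, -⟩ := exists_emb_of_dom (fun i => p i ^ e i) hq0 [47, 47] _ hD
  exact exists_isSTPP_122_of_injective φ hφ exists_isSTPP_122pow5_seed_47_47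

/-- **THE HOST LAW: every finite abelian group of order `≥ 48` admits an STPP family of size pattern `(1,2,2)⁵`** (CKSU Def. 5.1, tree `IsSTPP`).
No `ω` bound follows. [cite: CohnKleinbergSzegedyUmans2005, Def. 5.1] -/
theorem exists_isSTPP_122pow5_of_card_ge_48 {G : Type*} [AddCommGroup G] [Finite G] (hG : 48 ≤ Nat.card G) :
    ∃ A B C : Fin 5 → Finset G, IsSTPP A B C ∧ ∀ i, (A i).card = 1 ∧ (B i).card = 2 ∧ (C i).card = 2 := by
  classical
  by_cases hexp : 48 ≤ AddMonoid.exponent G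
  · obtain ⟨g, hg⟩ := AddMonoid.exists_addOrderOf_eq_exponent (AddMonoid.ExponentExists.of_finite (G := G))
    exact exists_isSTPP_122pow5_of_addOrderOf g (by rw [hg]; exact hexp)
  obtain ⟨ι, _, p, hp, e, ⟨g⟩⟩ := AddCommGroup.equiv_directSum_zmod_of_finite G
  let f : G ≃+ (Π i, ZMod (p i ^ e i)) :=
    g.trans (DirectSum.linearEquivFunOnFintype ℕ ι (fun i => ZMod (p i ^ e i))).toAddEquiv
  have hE1 : 1 ≤ AddMonoid.exponent G := Nat.pos_of_ne_zero AddMonoid.exponent_ne_zero_of_finite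
  have hdvd : ∀ i, p i ^ e i ∣ AddMonoid.exponent G := fun i => by
    have hinj : Function.Injective (AddMonoidHom.single (fun j => ZMod (p j ^ e j)) i) :=
      Pi.single_injective (M := fun j => ZMod (p j ^ e j)) i
    have h1 : addOrderOf (f.symm (AddMonoidHom.single (fun j => ZMod (p j ^ e j)) i 1)) = p i ^ e i := by
      rw [AddEquiv.addOrderOf_eq, addOrderOf_injective _ hinj, ZMod.addOrderOf_one]
    rw [← h1]
    exact AddMonoid.addOrder_dvd_exponent _
  have hcard : 48 ≤ ∏ i, p i ^ e i := by
    have : Nat.card G = ∏ i, p i ^ e i := by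
      rw [Nat.card_congr f.toEquiv, Nat.card_pi]
      simp [Nat.card_zmod]
    rw [← this]; exact hG
  by_cases h47 : AddMonoid.exponent G = 47
  · have h := exists_isSTPP_122pow5_pi_47 p e hp (fun i => h47 ▸ hdvd i) hcard
    exact exists_isSTPP_122_of_injective f.symm.toAddMonoidHom f.symm.injective h
  · have h := exists_isSTPP_122pow5_pi p e hp hE1 (by omega) hdvd hcard
    exact exists_isSTPP_122_of_injective f.symm.toAddMonoidHom f.symm.injective h

end Summit.MatrixMultiplication.OmegaCensus
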